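import Mathlib
import Literature.NumberTheory.Transcendental.KZCalculus
import Literature.NumberTheory.Transcendental.SemialgebraicLineDeriv
import Summits.KontsevichZagierPeriods.KontsevichZagierPeriods.Theses.TorsionLogs
import Summits.KontsevichZagierPeriods.KontsevichZagierPeriods.Theorems.HermiteRigidityGenusTwoCycleTransferPushforwardDimOne

/-!
# `CertificateDlogUnfolds` (item stmt-KontsevichZagierPeriods-13810, route TorsionLogs)

The W-step calibration in dimension `1` of route TorsionLogs: on `y² = x³ + 1` with the `6`-torsion
point `P = (2, 3)`, the function `F = (y − 2x + 1)³ (y − 1) / x³` has norm `F·F̄ = (x − 2)⁶`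
(`F̄` = image under the hyperelliptic involution `y ↦ −y`) and
`(x + 1) dx / ((x − 2) y) = (1/6) d log (F/F̄)`. On the real arc `x ∈ (−1, 0)` the two substitutions
of the card, `s = F/F̄` followed by `s = t⁻²`, compose to the single real-algebraic change of
variables

  `t = φ(x) = (F̄/F)^{1/2} = (2 − x)³ (1 + √(x³+1)) / (1 − 2x + √(x³+1))³`,

which maps `(−1, 0)` increasingly onto `(1, 2)` (`φ(−1) = 1`, `φ(0) = 2`) and satisfies
`φ′/φ = 3 (x + 1) / ((2 − x) √(x³+1))`, i.e. `(x + 1)/((2 − x)√(x³+1)) = (1/(3 φ)) · |φ′|`. Hence the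
two Kontsevich–Zagier integral representations

* `r  = [(−1, 0), (x + 1)/((2 − x)√(x³ + 1))]` and
* `r' = [(1, 2), 1/(3t)]` (value `(log 2)/3`)

differ by ONE move of rule (2) (`KZ.changeOfVariablesRel`): the certificate's `d log` is consumed by
a change of variables, never as a primitive. No new integral representation is built; the move is
checked on the two given representations (semialgebraicity of `φ` by the closure properties of
`ℚ`-semialgebraic functions, `SemialgebraicLineDeriv`; the one-dimensional Jacobian bookkeeping
`hasFDerivAt_fin_one`, `det_smul_id_fin_one` is reused from
`HermiteRigidityGenusTwoCycleTransferPushforwardDimOne.lean`).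

`CertificateDlogUnfolds_proof` concludes the route declaration
`Summit.KontsevichZagierPeriods.KontsevichZagierPeriods.Theses.TorsionLogs.CertificateDlogUnfolds`
by name.

References: M. Kontsevich, D. Zagier, *Periods* (2001), §1.2 rule (2); J. H. Silverman,
*Advanced Topics in the Arithmetic of Elliptic Curves* (1994), Ch. VI (Néron functions; the
`6`-torsion certificate).
-/

noncomputable section

open Set MeasureTheory
open Literature.NumberTheory.Transcendental Literature.ModelTheory.ExponentialFields

namespace Summit.KontsevichZagierPeriods.TorsionLogs.CertificateDlogUnfolds

/-! ### Real algebra and calculus of `φ(x) = (2 − x)³ (1 + √(x³+1)) / (1 − 2x + √(x³+1))³` -/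

/-- On `(−1, ∞)` the radicand `x³ + 1 = (x + 1)((x − 1/2)² + 3/4)` is positive. [folklore] -/
theorem cube_add_one_pos {x : ℝ} (h1 : -1 < x) : 0 < x ^ 3 + 1 := by
  have h : x ^ 3 + 1 = (x + 1) * ((x - 1 / 2) ^ 2 + 3 / 4) := by ring
  rw [h]
  exact mul_pos (by linarith) (by positivity)

/-- Derivative of `√(t³ + 1)` at a point where `t³ + 1 > 0`: `3t²/(2√(t³+1))`. [folklore] -/
theorem hasDerivAt_sqrt_cube {x : ℝ} (hx : 0 < x ^ 3 + 1) :
    HasDerivAt (fun t : ℝ => Real.sqrt (t ^ 3 + 1)) (3 * x ^ 2 / (2 * Real.sqrt (x ^ 3 + 1))) x := by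
  have h : HasDerivAt (fun t : ℝ => t ^ 3 + 1) (3 * x ^ 2) x := by
    simpa using (hasDerivAt_pow 3 x).add_const (1 : ℝ)
  exact h.sqrt hx.ne'

/-- The raw derivative of `φ(t) = (2 − t)³ (1 + √(t³+1)) / (1 − 2t + √(t³+1))³` (product and
quotient rules, before any simplification). [folklore] -/
theorem hasDerivAt_phi_raw {x : ℝ} (hx : 0 < x ^ 3 + 1)
    (hB : 1 - 2 * x + Real.sqrt (x ^ 3 + 1) ≠ 0) :
    HasDerivAt (fun t : ℝ => (2 - t) ^ 3 * (1 + Real.sqrt (t ^ 3 + 1)) /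
        (1 - 2 * t + Real.sqrt (t ^ 3 + 1)) ^ 3)
      (((3 * (2 - x) ^ 2 * (-1) * (1 + Real.sqrt (x ^ 3 + 1)) +
            (2 - x) ^ 3 * (3 * x ^ 2 / (2 * Real.sqrt (x ^ 3 + 1)))) *
            (1 - 2 * x + Real.sqrt (x ^ 3 + 1)) ^ 3 -
          (2 - x) ^ 3 * (1 + Real.sqrt (x ^ 3 + 1)) *
            (3 * (1 - 2 * x + Real.sqrt (x ^ 3 + 1)) ^ 2 *
              (-2 + 3 * x ^ 2 / (2 * Real.sqrt (x ^ 3 + 1))))) /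
        ((1 - 2 * x + Real.sqrt (x ^ 3 + 1)) ^ 3) ^ 2) x := by
  have hY := hasDerivAt_sqrt_cube hx
  have hu : HasDerivAt (fun t : ℝ => (2 - t) ^ 3) (3 * (2 - x) ^ 2 * (-1)) x := by
    simpa using ((hasDerivAt_id' x).const_sub (2 : ℝ)).fun_pow 3
  have hA : HasDerivAt (fun t : ℝ => 1 + Real.sqrt (t ^ 3 + 1))
      (3 * x ^ 2 / (2 * Real.sqrt (x ^ 3 + 1))) x := hY.const_add 1
  have h2 : HasDerivAt (fun t : ℝ => 1 - 2 * t) (-2) x := by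
    simpa using ((hasDerivAt_id' x).const_mul (2 : ℝ)).const_sub (1 : ℝ)
  have hB' : HasDerivAt (fun t : ℝ => 1 - 2 * t + Real.sqrt (t ^ 3 + 1))
      (-2 + 3 * x ^ 2 / (2 * Real.sqrt (x ^ 3 + 1))) x := h2.add hY
  have hB3 : HasDerivAt (fun t : ℝ => (1 - 2 * t + Real.sqrt (t ^ 3 + 1)) ^ 3)
      (3 * (1 - 2 * x + Real.sqrt (x ^ 3 + 1)) ^ 2 *
        (-2 + 3 * x ^ 2 / (2 * Real.sqrt (x ^ 3 + 1)))) x := by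
    simpa using hB'.fun_pow 3
  exact (hu.fun_mul hA).fun_div hB3 (pow_ne_zero 3 hB)

/-- **The logarithmic derivative of `φ`.** With `y = √(x³+1)` (so `y² = x³ + 1`, the only input
from the curve), the raw derivative of `φ` equals `3 (x + 1)(2 − x)² (1 + y) / (y (1 − 2x + y)³)`,
i.e. `φ′/φ = 3(x + 1)/((2 − x) y)`: this is the identity `d log (F̄/F)^{1/2} = 3 (x+1) dx/((2−x) y)`
for the `6`-torsion certificate `F`. [folklore] -/
theorem deriv_phi_eq {x y : ℝ} (hy2 : y ^ 2 = x ^ 3 + 1) (hy : 0 < y) (hB : 0 < 1 - 2 * x + y) :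
    ((3 * (2 - x) ^ 2 * (-1) * (1 + y) + (2 - x) ^ 3 * (3 * x ^ 2 / (2 * y))) *
            (1 - 2 * x + y) ^ 3 -
          (2 - x) ^ 3 * (1 + y) * (3 * (1 - 2 * x + y) ^ 2 * (-2 + 3 * x ^ 2 / (2 * y)))) /
        ((1 - 2 * x + y) ^ 3) ^ 2 =
      3 * (x + 1) * (2 - x) ^ 2 * (1 + y) / (y * (1 - 2 * x + y) ^ 3) := by
  have hy0 : y ≠ 0 := hy.ne'
  have hB0 : 1 - 2 * x + y ≠ 0 := hB.ne'
  -- the one identity that uses the curve `y² = x³ + 1`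
  have hI : (-3 * (1 + y) * y + 3 / 2 * (2 - x) * x ^ 2) * (1 - 2 * x + y) -
      3 * (2 - x) * (1 + y) * (3 / 2 * x ^ 2 - 2 * y) =
      3 * (1 + y) * (x + 1) * (1 - 2 * x + y) := by
    linear_combination (3 - 3 * x - 3 * y) * hy2
  have hN : (3 * (2 - x) ^ 2 * (-1) * (1 + y) + (2 - x) ^ 3 * (3 * x ^ 2 / (2 * y))) *
        (1 - 2 * x + y) ^ 3 -
      (2 - x) ^ 3 * (1 + y) * (3 * (1 - 2 * x + y) ^ 2 * (-2 + 3 * x ^ 2 / (2 * y))) =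
      (2 - x) ^ 2 * (1 - 2 * x + y) ^ 2 *
        ((-3 * (1 + y) * y + 3 / 2 * (2 - x) * x ^ 2) * (1 - 2 * x + y) -
          3 * (2 - x) * (1 + y) * (3 / 2 * x ^ 2 - 2 * y)) / y := by
    field_simp
    ring
  rw [hN, hI]
  field_simp

/-- **The Jacobian identity** `(x + 1)/((2 − x) y) = (1/(3 φ)) · ψ` behind the move (pure algebra in
`x` and `y = √(x³+1)`). [folklore] -/
theorem jacobian_eq {x y : ℝ} (hy : y ≠ 0) (hu : 2 - x ≠ 0) (hA : 1 + y ≠ 0)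
    (hB : 1 - 2 * x + y ≠ 0) :
    (x + 1) / ((2 - x) * y) =
      1 / (3 * ((2 - x) ^ 3 * (1 + y) / (1 - 2 * x + y) ^ 3)) *
        (3 * (x + 1) * (2 - x) ^ 2 * (1 + y) / (y * (1 - 2 * x + y) ^ 3)) := by
  rw [← mul_div_assoc (3 : ℝ) ((2 - x) ^ 3 * (1 + y)) ((1 - 2 * x + y) ^ 3), one_div_div,
    div_mul_div_comm, div_eq_div_iff (mul_ne_zero hu hy)
      (mul_ne_zero (mul_ne_zero three_ne_zero (mul_ne_zero (pow_ne_zero 3 hu) hA))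
        (mul_ne_zero hy (pow_ne_zero 3 hB)))]
  ring

/-- Positivity of the denominator `1 − 2x + √(x³+1)` for `x ≤ 0`. [folklore] -/
theorem den_pos {x : ℝ} (hx : x ≤ 0) : 0 < 1 - 2 * x + Real.sqrt (x ^ 3 + 1) := by
  have := Real.sqrt_nonneg (x ^ 3 + 1)
  linarith

/-- **`φ` is differentiable on `(−1, 0)` with derivative `ψ = 3(x+1)(2−x)²(1+y)/(y(1−2x+y)³)`,
`y = √(x³+1)`.** [folklore] -/
theorem hasDerivAt_phi {x : ℝ} (hx : x ∈ Ioo (-1 : ℝ) 0) :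
    HasDerivAt (fun t : ℝ => (2 - t) ^ 3 * (1 + Real.sqrt (t ^ 3 + 1)) /
        (1 - 2 * t + Real.sqrt (t ^ 3 + 1)) ^ 3)
      (3 * (x + 1) * (2 - x) ^ 2 * (1 + Real.sqrt (x ^ 3 + 1)) /
        (Real.sqrt (x ^ 3 + 1) * (1 - 2 * x + Real.sqrt (x ^ 3 + 1)) ^ 3)) x := by
  have hx3 : 0 < x ^ 3 + 1 := cube_add_one_pos hx.1
  have hYpos : 0 < Real.sqrt (x ^ 3 + 1) := Real.sqrt_pos.mpr hx3
  have hY2 : Real.sqrt (x ^ 3 + 1) ^ 2 = x ^ 3 + 1 := Real.sq_sqrt hx3.le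
  have hB : 0 < 1 - 2 * x + Real.sqrt (x ^ 3 + 1) := den_pos hx.2.le
  exact (hasDerivAt_phi_raw hx3 hB.ne').congr_deriv (deriv_phi_eq hY2 hYpos hB)

/-- The derivative `ψ` of `φ` is positive on `(−1, 0)`. [folklore] -/
theorem dphi_pos {x : ℝ} (hx : x ∈ Ioo (-1 : ℝ) 0) :
    0 < 3 * (x + 1) * (2 - x) ^ 2 * (1 + Real.sqrt (x ^ 3 + 1)) /
        (Real.sqrt (x ^ 3 + 1) * (1 - 2 * x + Real.sqrt (x ^ 3 + 1)) ^ 3) := by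
  have hx3 : 0 < x ^ 3 + 1 := cube_add_one_pos hx.1
  have hYpos : 0 < Real.sqrt (x ^ 3 + 1) := Real.sqrt_pos.mpr hx3
  have h1 : 0 < x + 1 := by linarith [hx.1]
  have hu : 0 < 2 - x := by linarith [hx.2]
  have hA : 0 < 1 + Real.sqrt (x ^ 3 + 1) := by linarith
  exact div_pos (mul_pos (mul_pos (mul_pos (by norm_num) h1) (pow_pos hu 2)) hA)
    (mul_pos hYpos (pow_pos (den_pos hx.2.le) 3))

/-- `φ` is continuous on `[−1, 0]` (its denominator does not vanish for `x ≤ 0`). [folklore] -/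
theorem continuousOn_phi :
    ContinuousOn (fun t : ℝ => (2 - t) ^ 3 * (1 + Real.sqrt (t ^ 3 + 1)) /
        (1 - 2 * t + Real.sqrt (t ^ 3 + 1)) ^ 3) (Icc (-1 : ℝ) 0) := by
  have hc1 : Continuous fun t : ℝ => (2 - t) ^ 3 * (1 + Real.sqrt (t ^ 3 + 1)) := by fun_prop
  have hc2 : Continuous fun t : ℝ => (1 - 2 * t + Real.sqrt (t ^ 3 + 1)) ^ 3 := by fun_prop
  exact hc1.continuousOn.div hc2.continuousOn fun t ht => pow_ne_zero 3 (den_pos ht.2).ne'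

/-- `φ` is strictly increasing on `[−1, 0]` (positive derivative inside). [folklore] -/
theorem strictMonoOn_phi :
    StrictMonoOn (fun t : ℝ => (2 - t) ^ 3 * (1 + Real.sqrt (t ^ 3 + 1)) /
        (1 - 2 * t + Real.sqrt (t ^ 3 + 1)) ^ 3) (Icc (-1 : ℝ) 0) := by
  refine strictMonoOn_of_deriv_pos (convex_Icc (-1 : ℝ) 0) continuousOn_phi fun x hx => ?_
  rw [interior_Icc] at hx
  rw [(hasDerivAt_phi hx).deriv]
  exact dphi_pos hx

/-- `φ(−1) = 1`. [folklore] -/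
theorem phi_neg_one :
    (fun t : ℝ => (2 - t) ^ 3 * (1 + Real.sqrt (t ^ 3 + 1)) /
        (1 - 2 * t + Real.sqrt (t ^ 3 + 1)) ^ 3) (-1) = 1 := by
  norm_num

/-- `φ(0) = 2`. [folklore] -/
theorem phi_zero :
    (fun t : ℝ => (2 - t) ^ 3 * (1 + Real.sqrt (t ^ 3 + 1)) /
        (1 - 2 * t + Real.sqrt (t ^ 3 + 1)) ^ 3) 0 = 2 := by
  norm_num

/-- **`φ` maps `(−1, 0)` onto `(1, 2)`** (intermediate values and strict monotonicity on `[−1, 0]`).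
[folklore] -/
theorem image_phi :
    (fun t : ℝ => (2 - t) ^ 3 * (1 + Real.sqrt (t ^ 3 + 1)) /
        (1 - 2 * t + Real.sqrt (t ^ 3 + 1)) ^ 3) '' Ioo (-1 : ℝ) 0 = Ioo (1 : ℝ) 2 := by
  apply Subset.antisymm
  · rintro _ ⟨x, hx, rfl⟩
    refine ⟨?_, ?_⟩
    · calc (1 : ℝ) = _ := phi_neg_one.symm
        _ < _ := strictMonoOn_phi (left_mem_Icc.mpr (by norm_num)) (Ioo_subset_Icc_self hx) hx.1
    · calc _ < _ := strictMonoOn_phi (Ioo_subset_Icc_self hx) (right_mem_Icc.mpr (by norm_num)) hx.2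
        _ = (2 : ℝ) := phi_zero
  · have h := intermediate_value_Ioo (show (-1 : ℝ) ≤ 0 by norm_num) continuousOn_phi
    have e1 : ((2 - -1) ^ 3 * (1 + Real.sqrt ((-1) ^ 3 + 1)) /
        (1 - 2 * -1 + Real.sqrt ((-1) ^ 3 + 1)) ^ 3 : ℝ) = 1 := phi_neg_one
    have e2 : ((2 - 0) ^ 3 * (1 + Real.sqrt (0 ^ 3 + 1)) /
        (1 - 2 * 0 + Real.sqrt (0 ^ 3 + 1)) ^ 3 : ℝ) = 2 := phi_zero
    rw [e1, e2] at h
    exact h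

/-- **`φ` is `ℚ`-semialgebraic** on any `ℚ`-semialgebraic `S ⊆ ℝ¹` (as a function of the coordinate
`p 0`): closure of `ℚ`-semialgebraic functions under `+`, `−`, `·`, `⁻¹`, powers and `√`
(Tarski–Seidenberg, `SemialgebraicLineDeriv`). [cite: BochnakCosteRoy1998, Prop. 2.2.6] -/
theorem phi_semialgebraic {S : Set (Fin 1 → ℝ)} (hS : IsSemialgebraic ℚ S) :
    IsSemialgebraicFunOn ℚ S (fun p => (2 - p 0) ^ 3 * (1 + Real.sqrt (p 0 ^ 3 + 1)) /
        (1 - 2 * p 0 + Real.sqrt (p 0 ^ 3 + 1)) ^ 3) := by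
  have hX : IsSemialgebraicFunOn ℚ S (fun p => p 0) :=
    (isSemialgebraicFunOn_aeval hS (MvPolynomial.X 0)).congr fun p _ => MvPolynomial.aeval_X p 0
  have h1 : IsSemialgebraicFunOn ℚ S (fun _ => (1 : ℝ)) := by
    simpa using isSemialgebraicFunOn_const_natCast hS 1
  have h2 : IsSemialgebraicFunOn ℚ S (fun _ => (2 : ℝ)) := isSemialgebraicFunOn_const_ofNat hS 2
  have hY : IsSemialgebraicFunOn ℚ S (fun p => Real.sqrt (p 0 ^ 3 + 1)) :=
    ((hX.fun_pow 3).fun_add h1).fun_sqrt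
  have hA : IsSemialgebraicFunOn ℚ S (fun p => 1 + Real.sqrt (p 0 ^ 3 + 1)) := h1.fun_add hY
  have hB : IsSemialgebraicFunOn ℚ S (fun p => (1 - 2 * p 0 + Real.sqrt (p 0 ^ 3 + 1)) ^ 3) :=
    ((h1.fun_sub (h2.fun_mul hX)).fun_add hY).fun_pow 3
  have hu : IsSemialgebraicFunOn ℚ S (fun p => (2 - p 0) ^ 3) := (h2.fun_sub hX).fun_pow 3
  exact ((hu.fun_mul hA).fun_mul hB.fun_inv).congr fun p _ => (div_eq_mul_inv _ _).symm

/-! ### The route declaration -/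

/-- **`CertificateDlogUnfolds`** (item stmt-KontsevichZagierPeriods-13810 of route TorsionLogs): any
two KZ integral representations `r = [(−1, 0), (x+1)/((2−x)√(x³+1))]` and `r' = [(1, 2), 1/(3t)]`
are KZ-equivalent, by the single rule-2 move `t = φ(x) = (2 − x)³(1 + √(x³+1))/(1 − 2x + √(x³+1))³`
(`= (F̄/F)^{1/2}` for the `6`-torsion certificate `F = (y − 2x + 1)³(y − 1)/x³` on `y² = x³ + 1`):
`φ` is `ℚ`-semialgebraic, injective with derivative `φ′ = 3φ(x+1)/((2−x)√(x³+1)) > 0` on `(−1, 0)`,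
maps it onto `(1, 2)`, and `(x+1)/((2−x)√(x³+1)) = (1/(3φ(x)))·|φ′(x)|` is the Jacobian identity.
[cite: KontsevichZagier2001, §1.2 rule (2)] -/
theorem CertificateDlogUnfolds_proof :
    Summit.KontsevichZagierPeriods.KontsevichZagierPeriods.Theses.TorsionLogs.CertificateDlogUnfolds := by
  unfold Summit.KontsevichZagierPeriods.KontsevichZagierPeriods.Theses.TorsionLogs.CertificateDlogUnfolds
  intro r r' hr hri hr' hr'i
  have hS : IsSemialgebraic ℚ {p : Fin 1 → ℝ | p 0 ∈ Ioo (-1 : ℝ) 0} := hr ▸ r.isSemialgebraic_domain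
  -- the move `Φ(p) = (φ (p 0))` and its derivative `Φ'(p) = ψ (p 0) • id`
  set φ : ℝ → ℝ := fun t => (2 - t) ^ 3 * (1 + Real.sqrt (t ^ 3 + 1)) /
    (1 - 2 * t + Real.sqrt (t ^ 3 + 1)) ^ 3 with hφ_def
  set ψ : ℝ → ℝ := fun x => 3 * (x + 1) * (2 - x) ^ 2 * (1 + Real.sqrt (x ^ 3 + 1)) /
    (Real.sqrt (x ^ 3 + 1) * (1 - 2 * x + Real.sqrt (x ^ 3 + 1)) ^ 3) with hψ_def
  set Φ : (Fin 1 → ℝ) → (Fin 1 → ℝ) := fun p _ => φ (p 0) with hΦ_def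
  set Φ' : (Fin 1 → ℝ) → ((Fin 1 → ℝ) →L[ℝ] (Fin 1 → ℝ)) :=
    fun p => ψ (p 0) • ContinuousLinearMap.id ℝ (Fin 1 → ℝ) with hΦ'_def
  have hdet : ∀ p, (Φ' p).det = ψ (p 0) := fun p =>
    HermiteRigidity.GenusTwoCycleTransfer.det_smul_id_fin_one _
  have hderφ : ∀ x ∈ Ioo (-1 : ℝ) 0, HasDerivAt φ (ψ x) x := fun x hx => hasDerivAt_phi hx
  -- rule (2) data: semialgebraic, differentiable, injective, the image, the Jacobian identity
  have hΦsa : IsSemialgebraicMapOn ℚ r.domain Φ := by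
    rw [hr]
    exact IsSemialgebraicMapOn.of_forall hS fun _ => phi_semialgebraic hS
  have hderiv : ∀ p ∈ r.domain, HasFDerivWithinAt Φ (Φ' p) r.domain p := by
    intro p hp
    rw [hr] at hp
    exact (HermiteRigidity.GenusTwoCycleTransfer.hasFDerivAt_fin_one φ (ψ (p 0)) p
      (hderφ (p 0) hp)).hasFDerivWithinAt
  have hinj : InjOn Φ r.domain := by
    intro p hp q hq h
    rw [hr] at hp hq
    have h0 : φ (p 0) = φ (q 0) := congr_fun h 0
    have hpq : p 0 = q 0 :=
      strictMonoOn_phi.injOn (Ioo_subset_Icc_self hp) (Ioo_subset_Icc_self hq) h0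
    funext i
    rw [Fin.fin_one_eq_zero i]
    exact hpq
  have himage : r'.domain = Φ '' r.domain := by
    rw [hr', hr]
    ext q
    simp only [mem_setOf_eq, mem_image]
    constructor
    · intro hq
      have hq' : q 0 ∈ φ '' Ioo (-1 : ℝ) 0 := by
        rw [image_phi]
        exact hq
      obtain ⟨x, hx, hxq⟩ := hq'
      refine ⟨fun _ => x, hx, ?_⟩
      funext i
      rw [Fin.fin_one_eq_zero i]
      exact hxq
    · rintro ⟨p, hp, rfl⟩
      have hp' : φ (p 0) ∈ Ioo (1 : ℝ) 2 := by
        rw [← image_phi]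
        exact mem_image_of_mem φ hp
      exact hp'
  have hjac : ∀ p ∈ r.domain, r.integrand p = r'.integrand (Φ p) * |(Φ' p).det| := by
    intro p hp
    have hp' : Φ p ∈ r'.domain := himage ▸ mem_image_of_mem Φ hp
    rw [hri hp, hr'i hp', hdet p]
    rw [hr] at hp
    have hx : p 0 ∈ Ioo (-1 : ℝ) 0 := hp
    have hx3 : 0 < p 0 ^ 3 + 1 := cube_add_one_pos hx.1
    have hY : Real.sqrt (p 0 ^ 3 + 1) ≠ 0 := (Real.sqrt_pos.mpr hx3).ne'
    have hu : (2 : ℝ) - p 0 ≠ 0 := by linarith [hx.2]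
    have hA : (1 : ℝ) + Real.sqrt (p 0 ^ 3 + 1) ≠ 0 := by
      have := Real.sqrt_nonneg (p 0 ^ 3 + 1)
      linarith
    have hB : (1 : ℝ) - 2 * p 0 + Real.sqrt (p 0 ^ 3 + 1) ≠ 0 := (den_pos hx.2.le).ne'
    rw [abs_of_pos (dphi_pos hx)]
    show (p 0 + 1) / ((2 - p 0) * Real.sqrt (p 0 ^ 3 + 1)) = 1 / (3 * φ (p 0)) * ψ (p 0)
    simp only [hφ_def, hψ_def]
    exact jacobian_eq hY hu hA hB
  exact KZ.changeOfVariablesRel_subset_relations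
    ⟨1, r, r', Φ, Φ', hΦsa, hderiv, hinj, himage, hjac, rfl⟩

end Summit.KontsevichZagierPeriods.TorsionLogs.CertificateDlogUnfolds

end
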